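import Summits.BirchSwinnertonDyer.Rank1Residual.Additive.GordManinConstant
import Summits.BirchSwinnertonDyer.Rank1Residual.X4.OptimalPeriod
import HarnessLib

/-!
# X4 at an additive `p ≥ 11`: the per-pair Kim-2026 Kurihara-number certificates with NO Manin
# datum for the strong curve outside "(G)-ordinary AND Kodaira type II/III/IV" (Edixhoven 1991 Thm 3)

HONEST FRAMING (cell `b2b-bsdres`, run/shared/lean/b2b/bsd-rank1-residual/, verbatim in every
file): the goal of the cell is to DELETE the COMBINATION-SHAPED residual classes of the
Birch–Swinnerton-Dyer formula for ALL analytic-rank `≤ 1` elliptic curves over `ℚ` — "full BSD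
formula for every rank `≤ 1` curve in class `C`" assembled STRICTLY from published theorems — so
that the rank-`≤ 1` remainder becomes exactly the CONSTRUCTION-SHAPED classes, which are TYPED
(missing-input `Prop`s), NOT attempted. This is not "finishing BSD". Sub-cell `additive-p2`
(CLASS-OWNERS row "X3/X4 additive — pot. good ordinary / X3♯(G-ord)"), generation 14: research
route; no claim beyond the stated classes; theorems only, no definition, no new named fact minted
here; X3♯(G-ord)/X4♯(G-ord) stay CONSTRUCTION-SHAPED; no label moves; nothing is booked.

WHAT THIS FILE DOES. The cell's PER-PAIR Kim-2026 consumers for an OPTIMAL curve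
(`X4/OptimalPeriod.lean`: `X4.bsdp_of_kim_rankZero_of_optimal`, `X4.bsdp_of_kim_rankOne_of_optimal`
— Kim 2026 Thm. 1.8 with the period binder supplied by optimality, `Ω(W) = |c|·Ω⁺_f`; the lane's
T-KIM0 / T-KIM1 certificates: ONE unit Kurihara number) keep ONE non-certificate input per pair,
"`D` optimal with `p ∤ c`" — print for `N ≤ 130000` (Agashe–Ribet–Stein 2006 Thm. 2.6 / Cremona),
Cremona's database beyond. At an ADDITIVE `p ≥ 11`, for a strong datum AT THE CONDUCTOR LEVEL and
a pair OUTSIDE Edixhoven's printed exception (`¬ TypeGOrd W p ∨ 4 < ord_p Δ_min`, i.e. not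
"(G)-ordinary of Kodaira type II/III/IV" — `Additive/GordManinConstant.lean`,
`Addv.not_dvd_maninConstant_of_exception`), that input is Edixhoven 1991 Thm. 3 (the two
print-faithful named facts `hEdx` = A130 and `hEdxK` = p239550): `Addv.bsdp_of_kim_rankZero_of_strong`,
`Addv.bsdp_of_kim_rankOne_of_strong`. Per pair (a Kurihara-number certificate is an input); NOT a
class theorem; the class-level content is in `GordManinConstant.lean`. Census of the exception
locus (Cremona `N < 5·10⁵`, `p ≥ 11`, optimal curves, `r ≤ 1`: 21 894 of 227 851 X4 pairs; beyond
`N = 130000`: 16 744 of 177 173): `HOME/b2b-bsdres-additive-p2/census/gen14/EDIXHOVEN-CENSUS.md`.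
Labels UNCHANGED; nothing booked.

References: B. Edixhoven, Progr. Math. 89 (1991) 25–39, Thm. 3 [EdixhovenManin1991]; C.-H. Kim,
Amer. J. Math. 148 (2026) Thm. 1.8 [Kim2022StructureSelmer]; A. Agashe–K. Ribet–W. Stein, PAMQ 2
(2006) Thm. 2.6 [AgasheRibetStein2006]; R. L. Miller, LMS J. Comput. Math. 14 (2011) Def. 1.1.
-/

noncomputable section

open scoped Classical NumberField

open WeierstrassCurve IsDedekindDomain IsDedekindDomain.HeightOneSpectrum NumberField
  Literature.NumberTheory.EllipticCurves
  Literature.NumberTheory.EllipticCurves.ModularForms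
  Literature.NumberTheory.EllipticCurves.Rank1Residual
  Literature.NumberTheory.EllipticCurves.Rank1Residual.Typed
  Literature.NumberTheory.DiophantineGeometry

namespace Summit.BirchSwinnertonDyer.Rank1Residual.Additive

variable (W : WeierstrassCurve ℚ) [W.IsElliptic] [W.IsGloballyMinimal] (p : ℕ) [hp : Fact p.Prime]

/-- **Rank `0`, ADDITIVE `p ≥ 11`, STRONG curve outside the Edixhoven exception: Kim's
Kurihara-number certificate gives `BSD(E,p)` with NO Manin datum** — `X4.bsdp_of_kim_rankZero_of_optimal`
(Kim 2026 Thm. 1.8 (6) `hKim`, GZK `hGZK`; `ρ̄` onto, `L(E,1) ≠ 0`, `p ∤ ∏ c_ℓ`, ONE unit Kurihara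
number at a cyclic Kolyvagin level) with its input `p ∤ c` supplied by Edixhoven 1991 Thm. 3
(`hEdx`, `hEdxK`) for a strong datum `D` at the conductor level and a pair with
`¬ TypeGOrd W p ∨ 4 < ord_p Δ_min`. Per pair; not a class theorem.
[cite: Kim2022StructureSelmer, Thm. 1.8 (6) and §1.3.5 (journal)] [cite: EdixhovenManin1991, Thm. 3]
[cite: Miller2011LMS, Def. 1.1] -/
theorem Addv.bsdp_of_kim_rankZero_of_strong
    (hKim : Kim2022_rankZero_padicValRat_sha_of_kuriharaNumber_ne_zero_of_maninConstant)
    (hGZK : rank_eq_analyticRank_of_analyticRank_le_one)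
    (hEdx : edixhoven_not_dvd_maninConstant_of_not_potentiallyGoodOrdinary)
    (hEdxK : edixhoven_not_dvd_maninConstant_of_kodairaSymbol_ne)
    (hp11 : 11 ≤ p) (hadd : Addv W p) (hsurj : W.HasSurjectiveModNGaloisRep p)
    (hL : W.entireLFunction 1 ≠ 0)
    [NeZero (W.conductorNorm ℤ)] (D : ModularParametrizationData W (W.conductorNorm ℤ))
    (hopt : ∀ z ∈ D.L.lattice, ∃ w ∈ periodLattice D.f, z = D.c * w)
    (hexc : ¬ TypeGOrd W p ∨ 4 < padicValInt p W.minimalDiscriminantInt)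
    (htam : ¬ p ∣ W.tamagawaProduct)
    (n : ℕ) [NeZero n] (hn : Kato.IsKolyvaginProduct W p 1 n)
    (hcyc : ∀ (ℓ : ℕ) [Fact ℓ.Prime], ℓ ∣ n →
      Nat.card {P : ((WeierstrassCurve.integralModelInt W).map
          (Int.castRingHom (ZMod ℓ))).toAffine.Point // p • P = 0} ≤ p)
    (ψ : (ℓ : ℕ) → (ZMod ℓ)ˣ →* Multiplicative (ZMod (p ^ 1)))
    (hψ : ∀ ℓ ∈ n.primeFactors, Function.Surjective (ψ ℓ))
    (hδ : kuriharaNumber D.f (p ^ 1) n ψ ≠ 0) : BSDp W p :=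
  X4.bsdp_of_kim_rankZero_of_optimal W p hKim hGZK (by omega) hsurj hL D hopt
    (Addv.not_dvd_maninConstant_of_exception W p hEdx hEdxK D hopt (by omega) hadd hexc)
    htam n hn hcyc ψ hψ hδ

/-- **Rank `1`, ADDITIVE `p ≥ 11`, STRONG curve outside the Edixhoven exception: Kim's
Kurihara-number certificate gives `BSD(E,p)` with NO Manin datum** — `X4.bsdp_of_kim_rankOne_of_optimal`
(Kim 2026 Thm. 1.8 (1), (4), (6) `hKim`, GZK; `ρ̄` onto, `L(E,1) = 0`, `r_an = 1`, a unit Kurihara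
number at a PRIME Kolyvagin level, `#Ш_an = q` a `p`-unit) with `p ∤ c` supplied by Edixhoven
1991 Thm. 3 for a strong datum at the conductor level and a pair with
`¬ TypeGOrd W p ∨ 4 < ord_p Δ_min`. Per pair; not a class theorem.
[cite: Kim2022StructureSelmer, Thm. 1.8 (1), (4), (6) and §1.3.5 (journal)]
[cite: EdixhovenManin1991, Thm. 3] [cite: Miller2011LMS, Def. 1.1] -/
theorem Addv.bsdp_of_kim_rankOne_of_strong
    (hKim : Kim2022_rankOne_card_sha_eq_one_of_kuriharaNumber_ne_zero_of_maninConstant)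
    (hGZK : rank_eq_analyticRank_of_analyticRank_le_one)
    (hEdx : edixhoven_not_dvd_maninConstant_of_not_potentiallyGoodOrdinary)
    (hEdxK : edixhoven_not_dvd_maninConstant_of_kodairaSymbol_ne)
    (hp11 : 11 ≤ p) (hadd : Addv W p) (hsurj : W.HasSurjectiveModNGaloisRep p)
    (hL : W.entireLFunction 1 = 0) (hr : W.analyticRank = 1)
    [NeZero (W.conductorNorm ℤ)] (D : ModularParametrizationData W (W.conductorNorm ℤ))
    (hopt : ∀ z ∈ D.L.lattice, ∃ w ∈ periodLattice D.f, z = D.c * w)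
    (hexc : ¬ TypeGOrd W p ∨ 4 < padicValInt p W.minimalDiscriminantInt)
    (ℓ : ℕ) [Fact ℓ.Prime] (hℓ : Kato.IsKolyvaginPrime W p 1 ℓ)
    (hcyc : Nat.card {P : ((WeierstrassCurve.integralModelInt W).map
        (Int.castRingHom (ZMod ℓ))).toAffine.Point // p • P = 0} ≤ p)
    (ψ : (ℓ' : ℕ) → (ZMod ℓ')ˣ →* Multiplicative (ZMod (p ^ 1)))
    (hψ : Function.Surjective (ψ ℓ)) (hδ : kuriharaNumber D.f (p ^ 1) ℓ ψ ≠ 0)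
    {q : ℚ} (hq : shaAn W = (q : ℂ)) (hv : padicValRat p q = 0) : BSDp W p :=
  X4.bsdp_of_kim_rankOne_of_optimal W p hKim hGZK (by omega) hsurj hL hr D hopt
    (Addv.not_dvd_maninConstant_of_exception W p hEdx hEdxK D hopt (by omega) hadd hexc)
    ℓ hℓ hcyc ψ hψ hδ hq hv

end Summit.BirchSwinnertonDyer.Rank1Residual.Additive

end
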